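import Summits.Schanuel.Schanuel.Theorems.ZilberEacDoubleCancellingDepth
import HarnessLib

/-!
# The double-cancelling regime: the perturbation is small and Lipschitz on the critical ball

Zilber's Exponential-Algebraic Closedness, case ladder (host summit Schanuel, cell `pub-schanuel`,
seat 2, gen 15).  Notation of `ZilberEacDoubleCancellingSystem` / `…Depth` (HANDOFF O59 PLAN).
For ONE label `n` this file checks the two hypotheses of `exists_zero_of_perturbed_implicit` for
the perturbation `Δ(v) = −μ(r₀ψ(e^{−w₀(v)}) + r₁ψ(e^{−w₁(v)}))`, `μ = 1/(2πisn)`, on the ball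
`B(V₀, Cρ)` around a clean solution `V₀` (`x₂(V₀) + r₀w₀(V₀) + r₁w₁(V₀) = c`), given the
quantitative largeness conditions that `ZilberEacDoubleCancellingExistence` establishes eventually:
both cancellations have depth `≥ M` on the ball (`re_w₁_ge`, `re_w₀_eq_of_clean`,
`re_expSum_ge_of_near`), hence `‖e^{−wⱼ}‖ ≤ e^{−M}`, `‖Δ‖ ≤ 2‖μ‖(|r₀|+|r₁|)e^{−M} ≤ ρ`, and
`Lip Δ ≤ 18‖μ‖(|r₀|Sg₀ + |r₁|Sg₁)e^{−M} ≤ 1/(2C)` (`exists_cancellingFixedPoint_lipschitz`,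
`norm_exp_neg_sub_le`).

* **`doubleCancelling_step`** — the three conclusions (depth, size, Lipschitz) for one label.

HONEST FRAMING: estimates for explicit members of an OPEN cell (`ECCell 3 2`); NOT Schanuel's
conjecture; EAC ⇏ SC.
-/

noncomputable section

open Complex Filter Topology Metric Set

set_option linter.dupNamespace false

namespace Summit.Schanuel.Schanuel.Theorems

section Step

/-- **One label of the double-cancelling regime.**  With `τ = Log(2πin/(r₀A))`, `S = e^{τ/e₀}`,
`P = Sω^{j₀}`, `Wⱼ(v) = Σ_{i<eⱼ} A_{j,i}P^{i+1}e^{(i+1)v/e₀}`, a clean solution `V₀`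
(`X₀ + V₀/e₀ + r₀W₀(V₀) + r₁W₁(V₀) = c`) and the listed largeness conditions: on `B(V₀, Cρ)` both
depths are `≥ M`, `‖Δ‖ ≤ ρ` and `Δ` is `1/(2C)`-Lipschitz. (new) -/
theorem doubleCancelling_step (e₀ e₁ : ℕ) (he₁ : 1 ≤ e₁) (he : e₁ < e₀) (A : Fin 2 → ℕ → ℂ)
    (r₀ r₁ : ℝ) (hr₀ : r₀ ≠ 0) (hneg : 0 ≤ -r₁ / r₀) (c : ℂ) (Aτ : ℂ) (j₀ : ℕ) {κ : ℝ}
    {n : ℕ} (hn : 1 ≤ n) {τ : ℂ} (hτ : τ = Complex.log (2 * Real.pi * I * (n : ℂ) / ((r₀ : ℂ) * Aτ)))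
    (hphase : κ * ‖A 1 (e₁ - 1)‖ ≤ (A 1 (e₁ - 1) * exp ((e₁ : ℂ) *
      (((Complex.arg (2 * Real.pi * I / ((r₀ : ℂ) * Aτ)) : ℝ) : ℂ) * I + 2 * Real.pi * I * (j₀ : ℂ)) /
        (e₀ : ℂ))).re)
    {ψ : ℂ → ℂ} {η : ℝ} (hψ : ∀ ε : ℂ, ‖ε‖ < η → ψ ε = ε * exp (ψ ε) ∧ ‖ψ ε‖ ≤ 2 * ‖ε‖)
    (hψlip : ∀ ε ε' : ℂ, ‖ε‖ < η → ‖ε'‖ < η → ‖ψ ε - ψ ε'‖ ≤ 6 * ‖ε - ε'‖)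
    (μ X₀ : ℂ) {V₀ : ℂ} {C ρ M : ℝ} (hC : 0 < C) (hρ : 0 < ρ)
    (hV₀ : ‖V₀‖ + C * ρ ≤ min 1 (κ / 8))
    (hclean : X₀ + V₀ / (e₀ : ℂ) + (r₀ : ℂ) * (∑ i ∈ Finset.range e₀, A 0 i *
        (exp (τ / (e₀ : ℂ)) * exp (2 * Real.pi * I / (e₀ : ℂ)) ^ j₀) ^ (i + 1) *
        exp ((((i : ℕ) : ℂ) + 1) * V₀ / (e₀ : ℂ))) +
      (r₁ : ℂ) * (∑ i ∈ Finset.range e₁, A 1 i *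
        (exp (τ / (e₀ : ℂ)) * exp (2 * Real.pi * I / (e₀ : ℂ)) ^ j₀) ^ (i + 1) *
        exp ((((i : ℕ) : ℂ) + 1) * V₀ / (e₀ : ℂ))) = c)
    (hS1 : 1 ≤ ‖exp (τ / (e₀ : ℂ))‖)
    (hSlow : 3 * (∑ i ∈ Finset.range (e₁ - 1), ‖A 1 i‖) * ‖exp (τ / (e₀ : ℂ))‖ ^ (e₁ - 1) ≤
      κ / 4 * ‖A 1 (e₁ - 1)‖ * ‖exp (τ / (e₀ : ℂ))‖ ^ e₁)
    (hM₁ : M ≤ κ / 2 * ‖A 1 (e₁ - 1)‖ * ‖exp (τ / (e₀ : ℂ))‖ ^ e₁)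
    (hM₀ : M ≤ -r₁ / r₀ * (κ / 2 * ‖A 1 (e₁ - 1)‖ * ‖exp (τ / (e₀ : ℂ))‖ ^ e₁) -
      (|c.re| + |X₀.re| + 1) / |r₀| - 1)
    (hB₀ : 3 * (∑ i ∈ Finset.range e₀, ‖A 0 i‖ * ‖exp (τ / (e₀ : ℂ))‖ ^ (i + 1)) * (C * ρ) ≤ 1)
    (hη : Real.exp (-M) < η)
    (hρΔ : 2 * ‖μ‖ * (|r₀| + |r₁|) * Real.exp (-M) ≤ ρ)
    (hlip : ‖μ‖ * (18 * (|r₀| * ∑ i ∈ Finset.range e₀, ‖A 0 i‖ * ‖exp (τ / (e₀ : ℂ))‖ ^ (i + 1) +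
        |r₁| * ∑ i ∈ Finset.range e₁, ‖A 1 i‖ * ‖exp (τ / (e₀ : ℂ))‖ ^ (i + 1))) *
        Real.exp (-M) ≤ 1 / (2 * C)) :
    let P : ℂ := exp (τ / (e₀ : ℂ)) * exp (2 * Real.pi * I / (e₀ : ℂ)) ^ j₀
    let W : Fin 2 → ℕ → ℂ → ℂ := fun j e v => ∑ i ∈ Finset.range e, A j i * P ^ (i + 1) *
      exp ((((i : ℕ) : ℂ) + 1) * v / (e₀ : ℂ))
    let Δ : ℂ → ℂ := fun v => -μ * ((r₀ : ℂ) * ψ (exp (-W 0 e₀ v)) + (r₁ : ℂ) * ψ (exp (-W 1 e₁ v)))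
    (∀ v ∈ closedBall V₀ (C * ρ), M ≤ (W 0 e₀ v).re ∧ M ≤ (W 1 e₁ v).re) ∧
      (∀ v ∈ closedBall V₀ (C * ρ), ‖Δ v‖ ≤ ρ) ∧
      (∀ v ∈ closedBall V₀ (C * ρ), ∀ v' ∈ closedBall V₀ (C * ρ),
        ‖Δ v - Δ v'‖ ≤ (1 / (2 * C)) * ‖v - v'‖) := by
  intro P W Δ
  have he₀ : 1 ≤ e₀ := by omega
  have he₁₀ : e₁ ≤ e₀ := he.le
  have hnpos : (0 : ℝ) < n := by exact_mod_cast hn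
  have he₀pos : (0 : ℝ) < e₀ := by exact_mod_cast (show 0 < e₀ by omega)
  set S : ℂ := exp (τ / (e₀ : ℂ)) with hSdef
  set ω : ℂ := exp (2 * Real.pi * I / (e₀ : ℂ)) with hω
  set a₁ : ℂ := A 1 (e₁ - 1) with ha₁
  have hωn : ‖ω‖ = 1 := by
    rw [hω, Complex.norm_exp]
    simp [Complex.div_re, Complex.mul_re]
  have hPn : ‖P‖ = ‖S‖ := by
    show ‖S * ω ^ j₀‖ = ‖S‖
    rw [norm_mul, norm_pow, hωn, one_pow, mul_one]
  -- coefficient sequences of the two exponential sums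
  set B₀ : ℕ → ℂ := fun i => A 0 i * P ^ (i + 1) with hB₀
  set B₁ : ℕ → ℂ := fun i => A 1 i * P ^ (i + 1) with hB₁
  have hW0 : ∀ v, W 0 e₀ v = ∑ i ∈ Finset.range e₀, B₀ i * exp ((((i : ℕ) : ℂ) + 1) * v / (e₀ : ℂ)) :=
    fun v => rfl
  have hW1 : ∀ v, W 1 e₁ v = ∑ i ∈ Finset.range e₁, B₁ i * exp ((((i : ℕ) : ℂ) + 1) * v / (e₀ : ℂ)) :=
    fun v => rfl
  have hB₀n : ∀ i, ‖B₀ i‖ = ‖A 0 i‖ * ‖S‖ ^ (i + 1) := fun i => by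
    simp only [hB₀]; rw [norm_mul, norm_pow, hPn]
  have hB₁n : ∀ i, ‖B₁ i‖ = ‖A 1 i‖ * ‖S‖ ^ (i + 1) := fun i => by
    simp only [hB₁]; rw [norm_mul, norm_pow, hPn]
  set Sg₀ : ℝ := ∑ i ∈ Finset.range e₀, ‖A 0 i‖ * ‖S‖ ^ (i + 1) with hSg₀
  set Sg₁ : ℝ := ∑ i ∈ Finset.range e₁, ‖A 1 i‖ * ‖S‖ ^ (i + 1) with hSg₁
  have hSg₀eq : ∑ i ∈ Finset.range e₀, ‖B₀ i‖ = Sg₀ := Finset.sum_congr rfl fun i _ => hB₀n i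
  have hSg₁eq : ∑ i ∈ Finset.range e₁, ‖B₁ i‖ = Sg₁ := Finset.sum_congr rfl fun i _ => hB₁n i
  have hSg₀nn : 0 ≤ Sg₀ := Finset.sum_nonneg fun i _ => by positivity
  have hSg₁nn : 0 ≤ Sg₁ := Finset.sum_nonneg fun i _ => by positivity
  -- points of the ball are small
  have hδ₀ : min 1 (κ / 8) ≤ 1 := min_le_left _ _
  have hδκ : min 1 (κ / 8) ≤ κ / 8 := min_le_right _ _
  have hCρ : (0 : ℝ) ≤ C * ρ := by positivity
  have hball : ∀ v ∈ closedBall V₀ (C * ρ), ‖v‖ ≤ min 1 (κ / 8) := by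
    intro v hv
    rw [mem_closedBall, dist_eq_norm] at hv
    calc ‖v‖ = ‖V₀ + (v - V₀)‖ := by ring_nf
      _ ≤ ‖V₀‖ + ‖v - V₀‖ := norm_add_le _ _
      _ ≤ ‖V₀‖ + C * ρ := by linarith
      _ ≤ min 1 (κ / 8) := hV₀
  have hV₀1 : ‖V₀‖ ≤ 1 := by linarith
  have hV₀mem : V₀ ∈ closedBall V₀ (C * ρ) := mem_closedBall_self hCρ
  -- depth of the fibre-1 cancellation on the ball
  have hdepth1 : ∀ v ∈ closedBall V₀ (C * ρ), κ / 2 * ‖a₁‖ * ‖S‖ ^ e₁ ≤ (W 1 e₁ v).re := by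
    intro v hv
    have hvδ := hball v hv
    have h := re_w₁_ge r₀ Aτ e₀ e₁ he₁ he₁₀ (A 1) j₀ (κ := κ) (δ := min 1 (κ / 8)) hδ₀
      (by linarith) hphase hn (by rw [← hτ]; exact hS1) hvδ
    rw [← hτ] at h
    have hsum : (∑ i ∈ Finset.range e₁, A 1 i * (exp (τ / (e₀ : ℂ)) *
        exp (2 * Real.pi * I / (e₀ : ℂ)) ^ j₀) ^ (i + 1) * exp ((((i : ℕ) : ℂ) + 1) * v / (e₀ : ℂ))) =
        W 1 e₁ v := rfl
    rw [hsum] at h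
    have hpos : 0 ≤ ‖a₁‖ * ‖S‖ ^ e₁ := by positivity
    nlinarith [h, hSlow]
  -- depth of the fibre-0 cancellation: first at `V₀`, then on the ball
  have hclean' : (X₀ + V₀ / (e₀ : ℂ)) + (r₀ : ℂ) * W 0 e₀ V₀ + (r₁ : ℂ) * W 1 e₁ V₀ = c :=
    hclean
  have hre0 := re_w₀_eq_of_clean hclean'
  have hdepth0V : -r₁ / r₀ * (κ / 2 * ‖a₁‖ * ‖S‖ ^ e₁) - (|c.re| + |X₀.re| + 1) / |r₀| ≤
      (W 0 e₀ V₀).re := by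
    have hW1V := hdepth1 V₀ hV₀mem
    -- `Re W₀(V₀) = (Re c - Re x₂)/r₀ + (-r₁/r₀) Re W₁(V₀)`
    have heq : (W 0 e₀ V₀).re = (c.re - (X₀ + V₀ / (e₀ : ℂ)).re) / r₀ +
        (-r₁ / r₀) * (W 1 e₁ V₀).re := by
      field_simp
      linarith [hre0]
    rw [heq]
    have h1 : -r₁ / r₀ * (κ / 2 * ‖a₁‖ * ‖S‖ ^ e₁) ≤ (-r₁ / r₀) * (W 1 e₁ V₀).re :=
      mul_le_mul_of_nonneg_left hW1V hneg
    have h2 : |(c.re - (X₀ + V₀ / (e₀ : ℂ)).re) / r₀| ≤ (|c.re| + |X₀.re| + 1) / |r₀| := by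
      rw [abs_div]
      refine div_le_div_of_nonneg_right ?_ (abs_nonneg _)
      have hx : |(X₀ + V₀ / (e₀ : ℂ)).re| ≤ |X₀.re| + 1 := by
        rw [Complex.add_re]
        refine (abs_add_le _ _).trans ?_
        gcongr
        refine (Complex.abs_re_le_norm _).trans ?_
        rw [norm_div, Complex.norm_natCast]
        calc ‖V₀‖ / (e₀ : ℝ) ≤ ‖V₀‖ / 1 :=
              div_le_div_of_nonneg_left (norm_nonneg _) one_pos (by exact_mod_cast he₀)
          _ ≤ 1 := by rw [div_one]; exact hV₀1
      calc |c.re - (X₀ + V₀ / (e₀ : ℂ)).re| ≤ |c.re| + |(X₀ + V₀ / (e₀ : ℂ)).re| := abs_sub _ _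
        _ ≤ |c.re| + (|X₀.re| + 1) := by linarith
        _ = |c.re| + |X₀.re| + 1 := by ring
    have h3 := neg_abs_le ((c.re - (X₀ + V₀ / (e₀ : ℂ)).re) / r₀)
    linarith
  have hdepth0 : ∀ v ∈ closedBall V₀ (C * ρ), M ≤ (W 0 e₀ v).re := by
    intro v hv
    have hv1 : ‖v‖ ≤ 1 := (hball v hv).trans hδ₀
    have hnear := re_expSum_ge_of_near B₀ (e := e₀) (e₀ := e₀) le_rfl he₀ hv1 hV₀1
    rw [← hW0, ← hW0, hSg₀eq] at hnear
    rw [mem_closedBall, dist_eq_norm] at hv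
    have hmove : 3 * Sg₀ * ‖v - V₀‖ ≤ 1 := by
      calc 3 * Sg₀ * ‖v - V₀‖ ≤ 3 * Sg₀ * (C * ρ) :=
            mul_le_mul_of_nonneg_left hv (by positivity)
        _ ≤ 1 := hB₀
    linarith [hdepth0V, hnear, hM₀]
  have hdepth : ∀ v ∈ closedBall V₀ (C * ρ), M ≤ (W 0 e₀ v).re ∧ M ≤ (W 1 e₁ v).re :=
    fun v hv => ⟨hdepth0 v hv, (hM₁.trans (hdepth1 v hv))⟩
  -- the small quantities `εⱼ = e^{−Wⱼ}`
  have hε : ∀ v ∈ closedBall V₀ (C * ρ), ‖exp (-W 0 e₀ v)‖ ≤ Real.exp (-M) ∧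
      ‖exp (-W 1 e₁ v)‖ ≤ Real.exp (-M) := by
    intro v hv
    obtain ⟨h0, h1⟩ := hdepth v hv
    constructor
    · rw [Complex.norm_exp, Complex.neg_re]; exact Real.exp_le_exp.2 (neg_le_neg h0)
    · rw [Complex.norm_exp, Complex.neg_re]; exact Real.exp_le_exp.2 (neg_le_neg h1)
  have hεη : ∀ v ∈ closedBall V₀ (C * ρ), ‖exp (-W 0 e₀ v)‖ < η ∧ ‖exp (-W 1 e₁ v)‖ < η :=
    fun v hv => ⟨lt_of_le_of_lt (hε v hv).1 hη, lt_of_le_of_lt (hε v hv).2 hη⟩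
  refine ⟨hdepth, ?_, ?_⟩
  · -- `‖Δ v‖ ≤ ρ`
    intro v hv
    obtain ⟨e0, e1⟩ := hε v hv
    obtain ⟨n0, n1⟩ := hεη v hv
    have hψ0 := (hψ _ n0).2
    have hψ1 := (hψ _ n1).2
    calc ‖Δ v‖ = ‖μ‖ * ‖(r₀ : ℂ) * ψ (exp (-W 0 e₀ v)) + (r₁ : ℂ) * ψ (exp (-W 1 e₁ v))‖ := by
          show ‖-μ * _‖ = _
          rw [norm_mul, norm_neg]
      _ ≤ ‖μ‖ * (|r₀| * (2 * Real.exp (-M)) + |r₁| * (2 * Real.exp (-M))) := by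
          refine mul_le_mul_of_nonneg_left ?_ (norm_nonneg _)
          refine (norm_add_le _ _).trans (add_le_add ?_ ?_)
          · rw [norm_mul, Complex.norm_real, Real.norm_eq_abs]
            exact mul_le_mul_of_nonneg_left (hψ0.trans (by linarith)) (abs_nonneg _)
          · rw [norm_mul, Complex.norm_real, Real.norm_eq_abs]
            exact mul_le_mul_of_nonneg_left (hψ1.trans (by linarith)) (abs_nonneg _)
      _ = 2 * ‖μ‖ * (|r₀| + |r₁|) * Real.exp (-M) := by ring
      _ ≤ ρ := hρΔ
  · -- Lipschitz
    intro v hv v' hv'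
    have hconv : Convex ℝ (closedBall V₀ (C * ρ)) := convex_closedBall _ _
    -- Lipschitz bounds for `εⱼ`
    have hder0 : ∀ u ∈ closedBall V₀ (C * ρ), HasDerivAt (W 0 e₀)
        (∑ i ∈ Finset.range e₀, B₀ i * (((((i : ℕ) : ℂ) + 1) / (e₀ : ℂ)) *
          exp ((((i : ℕ) : ℂ) + 1) * u / (e₀ : ℂ)))) u :=
      fun u _ => hasDerivAt_expSum B₀ e₀ e₀ u
    have hbd0 : ∀ u ∈ closedBall V₀ (C * ρ), ‖∑ i ∈ Finset.range e₀, B₀ i * (((((i : ℕ) : ℂ) + 1) / (e₀ : ℂ)) *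
        exp ((((i : ℕ) : ℂ) + 1) * u / (e₀ : ℂ)))‖ ≤ 3 * Sg₀ := by
      intro u hu
      rw [← hSg₀eq]
      exact norm_deriv_expSum_le B₀ le_rfl he₀ ((hball u hu).trans hδ₀)
    have hder1 : ∀ u ∈ closedBall V₀ (C * ρ), HasDerivAt (W 1 e₁)
        (∑ i ∈ Finset.range e₁, B₁ i * (((((i : ℕ) : ℂ) + 1) / (e₀ : ℂ)) *
          exp ((((i : ℕ) : ℂ) + 1) * u / (e₀ : ℂ)))) u :=
      fun u _ => hasDerivAt_expSum B₁ e₁ e₀ u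
    have hbd1 : ∀ u ∈ closedBall V₀ (C * ρ), ‖∑ i ∈ Finset.range e₁, B₁ i * (((((i : ℕ) : ℂ) + 1) / (e₀ : ℂ)) *
        exp ((((i : ℕ) : ℂ) + 1) * u / (e₀ : ℂ)))‖ ≤ 3 * Sg₁ := by
      intro u hu
      rw [← hSg₁eq]
      exact norm_deriv_expSum_le B₁ he₁₀ he₀ ((hball u hu).trans hδ₀)
    have hL0 := (norm_exp_neg_sub_le hconv hder0 (fun u hu => (hdepth u hu).1) hbd0).2 v hv v' hv'
    have hL1 := (norm_exp_neg_sub_le hconv hder1 (fun u hu => (hdepth u hu).2) hbd1).2 v hv v' hv'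
    obtain ⟨n0, n1⟩ := hεη v hv
    obtain ⟨n0', n1'⟩ := hεη v' hv'
    have hd0 := hψlip _ _ n0 n0'
    have hd1 := hψlip _ _ n1 n1'
    have hid : Δ v - Δ v' = -μ * ((r₀ : ℂ) * (ψ (exp (-W 0 e₀ v)) - ψ (exp (-W 0 e₀ v'))) +
        (r₁ : ℂ) * (ψ (exp (-W 1 e₁ v)) - ψ (exp (-W 1 e₁ v')))) := by
      show -μ * _ - -μ * _ = _
      ring
    rw [hid, norm_mul, norm_neg]
    calc ‖μ‖ * ‖(r₀ : ℂ) * (ψ (exp (-W 0 e₀ v)) - ψ (exp (-W 0 e₀ v'))) +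
          (r₁ : ℂ) * (ψ (exp (-W 1 e₁ v)) - ψ (exp (-W 1 e₁ v')))‖
        ≤ ‖μ‖ * (|r₀| * (6 * (3 * Sg₀ * Real.exp (-M) * ‖v - v'‖)) +
            |r₁| * (6 * (3 * Sg₁ * Real.exp (-M) * ‖v - v'‖))) := by
          refine mul_le_mul_of_nonneg_left ?_ (norm_nonneg _)
          refine (norm_add_le _ _).trans (add_le_add ?_ ?_)
          · rw [norm_mul, Complex.norm_real, Real.norm_eq_abs]
            exact mul_le_mul_of_nonneg_left (hd0.trans (by linarith)) (abs_nonneg _)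
          · rw [norm_mul, Complex.norm_real, Real.norm_eq_abs]
            exact mul_le_mul_of_nonneg_left (hd1.trans (by linarith)) (abs_nonneg _)
      _ = (‖μ‖ * (18 * (|r₀| * Sg₀ + |r₁| * Sg₁)) * Real.exp (-M)) * ‖v - v'‖ := by ring
      _ ≤ 1 / (2 * C) * ‖v - v'‖ := mul_le_mul_of_nonneg_right hlip (norm_nonneg _)

end Step

end Summit.Schanuel.Schanuel.Theorems

end
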